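import Summits.BirchSwinnertonDyer.BirchSwinnertonDyer.Theorems.RamifiedSevenEllipticUnitsLemmaXiRamifiedValues
import HarnessLib

set_option linter.dupNamespace false
set_option autoImplicit false

/-!
# Lemma Ξ, kernel side (IV): from Deuring-shaped VALUE data to the hypotheses of (P1)/(P5)

Helper file for the K7r Value crux `EllipticUnitValueSevenOfGZK` (stmt-BirchSwinnertonDyer-19945), line
`rubin-formula-zp` v4, stub `stub_rubinPackageSevenZp`, clauses (P1)/(P5). Glue between file (III)
(`…LemmaXiRamifiedValues`: `‖τ(α/σα) − 1‖² ≤ p⁻¹` at a ramified prime of a quadratic field) and files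
(I)/(II) (`…LemmaXiAvatarNorm`, `…LemmaXi`: (P5) and (P1) from the `p`-adic size of the values of
`φ_ac = φ(φ∘c)⁻¹`): if at a finite place `w` the Hecke character `φ` is unramified at `c • w` and its
values at `w` and `c • w` are `σ'(α)` and `σ'(cα)` for an embedding `σ' : K → ℂ` and some `α ∈ 𝓞_K ∖ 𝔭`
— the shape of Deuring's theorem, Silverman ATAEC II Cor. 10.4.1 (a): `ψ_{E/K}(𝔓) ∈ 𝓞_K` generates
`N𝔓`, with II Thm. 9.2/Ex. 2.30 (conjugation-equivariance) — then
`‖ι⁻¹(φ_ac(ϖ_w)) − 1‖² ≤ p⁻¹` in `ℂ_p` (`sq_norm_φac_value_sub_one_le`), with equality when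
`(cα − α)² = p·u`, `u ∉ 𝔭` (`sq_norm_φac_value_sub_one_eq`). Consequently (P1) holds for every Rubin
datum whose `φ` has Deuring-shaped values off a finite set (`RubinPadicLFunctionData.galConj_η_eq_of_values`,
`RubinPadicLFunctionData.ξ_eq_φac_of_values`).

References: Silverman, *Advanced Topics*, II Thm. 9.2, Cor. 10.4.1, Ex. 2.30; [BKNO] arXiv:2608.06879 Def. 4.2.
-/

noncomputable section

open scoped Classical NNReal Topology Pointwise
open NumberField IsDedekindDomain Field
  Literature.NumberTheory.EllipticCurves
  Literature.NumberTheory.EllipticCurves.BurungaleKobayashiNakamuraOta2026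
  Literature.NumberTheory.GaloisRepresentations

namespace Summit.BirchSwinnertonDyer.BirchSwinnertonDyer.Theorems.RamifiedSevenEllipticUnits

namespace LemmaXi

variable {K : Type} [Field K] [NumberField K] {p : ℕ} [hp : Fact p.Prime]

/-- **The value of `φ_ac = φ(φ∘c)⁻¹` at `w` from Deuring-shaped data**: if `φ` is unramified at `c • w`,
`φ(ϖ_w) = σ'(α)` and `φ(ϖ_{c•w}) = σ'(cα)`, then `ι⁻¹(φ_ac(ϖ_w)) = τ(α / cα)` with
`τ = ι⁻¹ ∘ σ' : K → ℚ̄_p`. [cite: SilvermanATAEC1994, Ch. II Cor. 10.4.1 (a) and Thm. 9.2] -/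
theorem symm_φac_valueAtUniformizer_eq (c : K ≃ₐ[ℚ] K) (ι : PadicAlgCl p ≃+* ℂ) (σ' : K →+* ℂ)
    (φ : HeckeCharacter K) {w : HeightOneSpectrum (𝓞 K)} {α : 𝓞 K} (hw : φ.IsUnramifiedAt (c • w))
    (hφw : φ.valueAtUniformizer w = σ' (α : K))
    (hφcw : φ.valueAtUniformizer (c • w) = σ' (c (α : K))) :
    ι.symm ((φ * (HeckeCharacter.galConj c φ)⁻¹).valueAtUniformizer w) =
      (ι.symm.toRingHom.comp σ') ((α : K) / c (α : K)) := by
  rw [HeckeCharacter.valueAtUniformizer_mul', HeckeCharacter.valueAtUniformizer_inv',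
    HeckeCharacter.valueAtUniformizer_galConj_of_isUnramifiedAt c φ w hw, hφw, hφcw, ← map_inv₀,
    ← map_mul, ← div_eq_mul_inv]
  rfl

/-- **`‖ι⁻¹(φ_ac(ϖ_w)) − 1‖² ≤ p⁻¹` from Deuring-shaped values** at a prime `p ∣ d_K` of a QUADRATIC
field (`𝔭 ∋ p`), for `α ∉ 𝔭`: file (III)'s principal-unit bound at `τ = ι⁻¹ ∘ σ'`.
[cite: SilvermanATAEC1994, Ch. II Cor. 10.4.1 (a)] [cite: NeukirchANT1999, Ch. I §9 Prop. (9.6)] -/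
theorem sq_norm_φac_value_sub_one_le (h2 : Module.finrank ℚ K = 2)
    (hdvd : (p : ℤ) ∣ NumberField.discr K) (𝔭 : HeightOneSpectrum (𝓞 K))
    (hp𝔭 : ((p : ℕ) : 𝓞 K) ∈ 𝔭.asIdeal) (c : K ≃ₐ[ℚ] K) (ι : PadicAlgCl p ≃+* ℂ) (σ' : K →+* ℂ)
    (φ : HeckeCharacter K) {w : HeightOneSpectrum (𝓞 K)} {α : 𝓞 K} (hw : φ.IsUnramifiedAt (c • w))
    (hα : α ∉ 𝔭.asIdeal) (hφw : φ.valueAtUniformizer w = σ' (α : K))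
    (hφcw : φ.valueAtUniformizer (c • w) = σ' (c (α : K))) :
    ‖((ι.symm ((φ * (HeckeCharacter.galConj c φ)⁻¹).valueAtUniformizer w) : PadicAlgCl p) : ℂ_[p])
      - 1‖ ^ 2 ≤ ((p : ℝ))⁻¹ := by
  rw [symm_φac_valueAtUniformizer_eq c ι σ' φ hw hφw hφcw]
  exact norm_embedding_div_smul_sub_one_sq_le h2 hdvd 𝔭 hp𝔭 c (ι.symm.toRingHom.comp σ') hα

/-- **Equality `‖ι⁻¹(φ_ac(ϖ_w)) − 1‖² = p⁻¹`** when moreover `(cα − α)² = p·u` with `u ∉ 𝔭`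
(e.g. `K = ℚ(√−7)`, `α = (1 + √−7)/2`). [cite: SilvermanATAEC1994, Ch. II Cor. 10.4.1 (a)]
[cite: NeukirchANT1999, Ch. I §9 Prop. (9.6)] -/
theorem sq_norm_φac_value_sub_one_eq (h2 : Module.finrank ℚ K = 2)
    (hdvd : (p : ℤ) ∣ NumberField.discr K) (𝔭 : HeightOneSpectrum (𝓞 K))
    (hp𝔭 : ((p : ℕ) : 𝓞 K) ∈ 𝔭.asIdeal) (c : K ≃ₐ[ℚ] K) (ι : PadicAlgCl p ≃+* ℂ) (σ' : K →+* ℂ)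
    (φ : HeckeCharacter K) {w : HeightOneSpectrum (𝓞 K)} {α u : 𝓞 K} (hw : φ.IsUnramifiedAt (c • w))
    (hα : α ∉ 𝔭.asIdeal) (hu : u ∉ 𝔭.asIdeal) (hδ : (c • α - α) ^ 2 = (p : ℕ) * u)
    (hφw : φ.valueAtUniformizer w = σ' (α : K)) (hφcw : φ.valueAtUniformizer (c • w) = σ' (c (α : K))) :
    ‖((ι.symm ((φ * (HeckeCharacter.galConj c φ)⁻¹).valueAtUniformizer w) : PadicAlgCl p) : ℂ_[p])
      - 1‖ ^ 2 = ((p : ℝ))⁻¹ := by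
  rw [symm_φac_valueAtUniformizer_eq c ι σ' φ hw hφw hφcw]
  exact norm_embedding_div_smul_sub_one_sq_eq h2 hdvd 𝔭 hp𝔭 c (ι.symm.toRingHom.comp σ') hα hu hδ

end LemmaXi

/-! ## (P1) for a Rubin datum whose `φ` has Deuring-shaped values -/

section Datum

open LemmaXi

variable {W : WeierstrassCurve ℚ} [W.IsElliptic] {p : ℕ} [hp : Fact p.Prime]
  {K : Type} [Field K] [NumberField K] {c : K ≃ₐ[ℚ] K} {𝔭 : HeightOneSpectrum (𝓞 K)}
  {κ : ZpExtension K p} {γ : absoluteGaloisGroup K} {ι : PadicAlgCl p ≃+* ℂ} {φ : HeckeCharacter K}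
  {Ω : ℂ} {𝓔 : AcDualExpSystem W p K 𝔭 κ ι} {D : EllipticUnitClassData W p K 𝔭 κ γ ι φ Ω 𝓔}

/-- **LEMMA Ξ from Deuring-shaped values.** For a Rubin `p`-adic `L`-function datum `R` over a
QUADRATIC field `K` in which `p ∣ d_K` ramifies (`𝔭 ∋ p`): if off a finite set of finite places `φ` is
unramified at `w` and `c • w` with `φ(ϖ_w) = σ'(α_w)`, `φ(ϖ_{c•w}) = σ'(c α_w)` for a fixed embedding
`σ' : K → ℂ` and some `α_w ∈ 𝓞_K ∖ 𝔭` (Silverman ATAEC II Cor. 10.4.1 (a) with Thm. 9.2), then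
`HeckeCharacter.galConj c R.η = R.η`. [cite: BurungaleKobayashiNakamuraOta2026, Def. 4.2 (arXiv:2608.06879 p. 24) (claim; preprint; fields of the datum)]
[cite: SilvermanATAEC1994, Ch. II Cor. 10.4.1 (a) and Thm. 9.2] -/
theorem RubinPadicLFunctionData.galConj_η_eq_of_values (R : RubinPadicLFunctionData W p K c 𝔭 κ γ ι φ Ω 𝓔 D)
    (h2 : Module.finrank ℚ K = 2) (hdvd : (p : ℤ) ∣ NumberField.discr K)
    (hp𝔭 : ((p : ℕ) : 𝓞 K) ∈ 𝔭.asIdeal) (σ' : K →+* ℂ)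
    (hφ : ∃ S : Set (HeightOneSpectrum (𝓞 K)), S.Finite ∧ ∀ w ∉ S,
      φ.IsUnramifiedAt w ∧ φ.IsUnramifiedAt (c • w) ∧ ∃ α : 𝓞 K, α ∉ 𝔭.asIdeal ∧
        φ.valueAtUniformizer w = σ' (α : K) ∧ φ.valueAtUniformizer (c • w) = σ' (c (α : K))) :
    HeckeCharacter.galConj c R.η = R.η := by
  obtain ⟨S, hS, hS'⟩ := hφ
  have hp1 : ((p : ℝ))⁻¹ < 1 := inv_lt_one_of_one_lt₀ (by exact_mod_cast hp.out.one_lt)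
  refine RubinPadicLFunctionData.galConj_η_eq R ⟨S, hS, fun w hw ↦ ?_⟩
  obtain ⟨hunr, hunrc, α, hα, hφw, hφcw⟩ := hS' w hw
  refine ⟨hunr.mul' ((HeckeCharacter.isUnramifiedAt_galConj_iff c φ w).mpr hunrc).inv', ?_⟩
  exact norm_lt_one_of_sq_le (sq_norm_φac_value_sub_one_le h2 hdvd 𝔭 hp𝔭 c ι σ' φ hunrc hα hφw hφcw) hp1

/-- **(P1) from Deuring-shaped values**: under the hypotheses of `galConj_η_eq_of_values`,
`R.ξ = φ(φ∘c)⁻¹`. [cite: BurungaleKobayashiNakamuraOta2026, Def. 4.2 (arXiv:2608.06879 p. 24) (claim; preprint; fields of the datum)] -/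
theorem RubinPadicLFunctionData.ξ_eq_φac_of_values (R : RubinPadicLFunctionData W p K c 𝔭 κ γ ι φ Ω 𝓔 D)
    (h2 : Module.finrank ℚ K = 2) (hdvd : (p : ℤ) ∣ NumberField.discr K)
    (hp𝔭 : ((p : ℕ) : 𝓞 K) ∈ 𝔭.asIdeal) (σ' : K →+* ℂ)
    (hφ : ∃ S : Set (HeightOneSpectrum (𝓞 K)), S.Finite ∧ ∀ w ∉ S,
      φ.IsUnramifiedAt w ∧ φ.IsUnramifiedAt (c • w) ∧ ∃ α : 𝓞 K, α ∉ 𝔭.asIdeal ∧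
        φ.valueAtUniformizer w = σ' (α : K) ∧ φ.valueAtUniformizer (c • w) = σ' (c (α : K))) :
    R.ξ = φ * (HeckeCharacter.galConj c φ)⁻¹ :=
  R.ξ_eq_of_galConj_η_eq (RubinPadicLFunctionData.galConj_η_eq_of_values R h2 hdvd hp𝔭 σ' hφ)

end Datum

end Summit.BirchSwinnertonDyer.BirchSwinnertonDyer.Theorems.RamifiedSevenEllipticUnits

end
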